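import Summits.Ventures.HSemireg.AmplificationChainSiegel
import Summits.Ventures.HSemireg.PerfectComplexChartSpread
import Literature.AlgebraicGeometry.HodgeTheory.SemiregularReducedObstructions
import HarnessLib

/-!
# Venture HSemireg — the amplification chain's deformation step SPLIT at its printed seam: Pridham's reduced obstruction
# theory (the REFEREED tree fact, consumed here for the first time) + ONE Hodge-free algebraisation assumption BY NAME
# ⟹ the local variational Hodge statement for the SHEAF class ⟹ the Weil / `𝒜_g` corollaries

HONEST FRAMING. Lean index of the computation cell `pub-hsemireg` (seat p7, «assembly»). Nothing about any explicit variety is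
asserted; every published input is a hypothesis BY NAME; nothing here says HC, HC_CM or HC_AV is proved. ONE definition (an
assumption BY NAME, Hodge-free), theorems otherwise; no `sorry`, no new axiom, no Literature fact declared.

## What this file does (and what it does NOT do)

The tree now holds Pridham's Cor. 2.25 + Rem. 2.27 (with Rem. 2.21 `𝓛 = σ` and Lemma 1.8 `o_e`) AS PRINTED in the finite locally
free case, INFINITESIMAL form: `Literature.AlgebraicGeometry.HodgeTheory.Pridham2024_ISemiregular_liftsOverHodgeLocus_model`
(seat lit-3, `SemiregularReducedObstructions.lean`; refereed: Forum Math. Sigma 12 (2024) e126). Its conclusion is a LIFTING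
statement along small extensions at the Artinian points of the base centred at `s₀`; its module docstring's discharge table
leaves two rows to the assembly: «iterate this fact along small extensions» and «consumed by: l.f.p. moduli + formally smooth
⟹ smooth ⟹ étale-local section — NOT in the tree». Theory seat 3's split of «formal ⟹ algebraic along the component»
(`theory/TH3-ALGEBRAISATION.md` §0) is (F) formal · (E) effectivity · (C) convergence · (G) globalisation; in the tree, (G) and
the spread are KERNEL theorems (`PerfectComplexChartSpread.lean` §1, `BlochSemiregularSpreadGlobal.lean`), and — for the
perfect-complex door — (F)+(E)+(C) together are ONE assumption BY NAME, `PerfectComplexDeformsOverEtaleNbhd C Adm`, whose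
on-paper derivation (L1)–(L6) MIXES the Hodge-theoretic step (Pridham / Buchweitz–Flenner / Deligne) with the algebraisation
step (Lieblich / EGA IV §17). THIS FILE separates them where a real carrier exists, i.e. for SHEAVES:

* (F) := the refereed fact BY NAME `Pridham2024_ISemiregular_liftsOverHodgeLocus_model` (hypothesis `hP`; an unproved
  `def … : Prop` of the Literature layer — taking it as a hypothesis makes every theorem below CONDITIONAL on it, by name);
* (E)+(C) := §1 `SheafDeformsOverEtaleNbhdOfLifts C` (def; ASSUMPTION BY NAME of the venture, HODGE-FREE and
  SEMIREGULARITY-FREE): INPUT = the fact's lifting conclusion BY NAME (seat lit-3's predicate `LiftsOverArtinianPointsAt π s₀ X₀ e E₀` =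
  the fact's telescope λ-abstracted; carriers `LiftsAlong`, `IsVectorBundle`, the three `IsPullback` squares), OUTPUT = theory seat 3's étale conclusion shape VERBATIM (an étale
  `ρ : T ⟶ S`, `t₀ ↦ s₀`, a bounded complex of vector bundles `ℰ` on `𝒳 ×_S T` with `ch_p(ℰ|_{t₀}) = (e⁻¹)^* ch_p(E₀)`, here for
  every `p`); printed shape: [Perry2022] proof of Prop. 8.1 («Since `𝓜° → U` is smooth … there exists [an] étale morphism
  `U′ → U` with a point `0′ ↦ 0` such that `𝓜°_{U′} → U′` admits a section taking `0′` to `E_{0′}`»); THE KERNEL LINKS IT TO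
  NOTHING (wording rule F-1 applies to it exactly as to `PerfectComplexDeformsOverEtaleNbhd`);
* (G) + spread := kernel (§2, re-assembled pointwise from theory seat 3's §1 theorems and the tree's SGA 1 XII 3.1 (iii)).

§2 THEOREM `localVariationalHodgeFor_bfSheafClass_of_pridham_of_sheafDeformsOverEtaleNbhdOfLifts`:
`hP ∧ SheafDeformsOverEtaleNbhdOfLifts C ⟹ LocalVariationalHodgeFor (bfSheafClass C)` — the door-agnostic currency of
`AmplificationChainAssembly.lean`; §3 the Weil-ladder / g = 4 / `𝒜_g`-component corollaries by composition with the landed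
door-agnostic theorems (nothing new is decided there).

HONEST WORDS (read before citing anything from this file). (i) For the SHEAF class the refereed tree fact
`BuchweitzFlenner2003_variationalHodge_ISemiregular_model` ALREADY gives `LocalVariationalHodgeFor (bfSheafClass C)` with NO venture
assumption (`localVariationalHodgeFor_bfSheafClass`); the §2 theorem has a LARGER trust base (one refereed fact + one assumption)
and is NOT the theorem to cite for a vector-bundle row — it is a SECOND derivation. (ii) Its point is the INTERFACE: it is the
first declaration of the tree that CONSUMES the Pridham rendering, so the kernel certifies that lit-3's typed conclusion is
exactly the input an algebraisation step needs, and that what then remains un-linked is ONE Hodge-free sentence of standard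
deformation theory (algebraic stack of sheaves / complexes + infinitesimal criterion + étale quasi-section + strictification) —
the same residual the PERFECT-COMPLEX door has in its own split, `AmplificationChainPridhamPerfect.lean` (seat p7: there the
Hodge-theoretic half `PridhamPerfectLifts C` is Cor. 2.25 + Rem. 2.27 rendered for STRICTLY PERFECT complexes on target seat 7's
real `σ`-carrier `HomComplex.IsISemiregularC` with the DERIVED lifting predicate `PerfectLiftsOverArtinianPointsAt` — a printed,
refereed statement typed VENTURE-side, hypothesis by name, NOT a Literature fact — whereas HERE the Hodge-theoretic half is the
LITERATURE FACT itself). (iii) NO g = 4 census row of the cell is a sheaf (the STEP-0 (C) object `Φ(I_Z) ⊗ M_B` is a two-term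
complex; its row runs through `AmplificationChainPridhamPerfect.lean`), so the g = 4 corollary of §3 has NO by-value instance
tonight; it records the trust-sentence SHAPE «Pridham (refereed Literature fact, typed as printed) + algebraisation (assumption
by name, Hodge-free) + Deligne's reach (refereed)» for any future vector-bundle seed. (iv) The «iterate along small extensions»
row (a vector bundle on `X_A` for EVERY Artinian point `A` centred at `s₀`, i.e. a formal deformation along the Hodge locus) is
NOT needed by this interface — the infinitesimal criterion of smoothness consumes the small-extension lifting property itself —
and is proved separately in `ArtinianPointLifting.lean` (seat p7, `exists_vectorBundle_pullback_iso_of_liftsOverArtinianPointsAt`).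

## On-paper derivation of §1 for its intended inputs (NOT kernel-linked; locators as read by theory seats 2/3 and referee ref-2
## for the cell's (L1)/(L2) and by theory seat 3 for `PerfectComplexDeformsOverEtaleNbhd`)

Let `𝓜 → S` be the algebraic stack, locally of finite presentation over `S`, of `S`-flat coherent sheaves on `𝒳/S` — equivalently
near `[E₀]`, of universally gluable `S`-perfect complexes [Lieblich2006, Thm. 4.2.1] (a vector bundle has `Ext^{<0} = 0`; an
`A`-perfect deformation of a vector bundle over a local Artinian `A` is a vector bundle, Nakayama). Take a smooth atlas `V → 𝓜`
and `v₀ ∈ V(ℂ)` over the point `[(e⁻¹)^*E₀]` of the fibre `𝓜_{s₀}`. CLAIM: `V → S` is smooth at `v₀`. By the infinitesimal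
criterion at a point [EGAIV4, Prop. 17.14.2; GortzWedhorn2023, Thm. 18.63] it suffices to lift, for every small extension
`A ↠ B` of local Artinian `ℂ`-algebras with residue field `ℂ`, every `B`-point of `V` centred at `v₀` across every `A`-point
`a` of `S` extending its image: the `B`-point gives a `B`-flat coherent `F` on `X_B = 𝒳 ×_S Spec B` whose closed fibre is `E₀`
(carried by `e`), hence a VECTOR BUNDLE on `X_B` (nilpotent Nakayama: lift a local basis of the closed fibre; the kernel `K`
has `K ⊗_B ℂ = 0` by `B`-flatness of `F`, and `𝔪_B` is nilpotent, so `K = 0`); the HYPOTHESIS of §1 lifts `F` to a vector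
bundle on `X_A = 𝒳 ×_S Spec A` (`LiftsAlong`), an `A`-point of `𝓜` over `a` extending `[F]`; `V → 𝓜` being smooth, the
`B`-point of `V` lifts compatibly to an `A`-point of `V`. (The HYPOTHESIS — lifting along EVERY small extension over EVERY
`A`-point of `S` centred at `s₀` — is exactly «the versal base of `E₀` relative to the formal germ `Ŝ_{s₀}` is formally SMOOTH
over `Ŝ_{s₀}`», [BuchweitzFlenner2003] Thm. 6.7 (1) with `𝔞 = 0`, theory seat 2's `TH2-W2-PRIDHAM-INPUT.md` §7: the smooth case,
which is what the infinitesimal criterion consumes; the weaker «a formal family over `Ŝ_{s₀}` exists» would NOT feed it and is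
not used.) Hence `V → S` is smooth on an open `V° ∋ v₀`, and [EGAIV4,
Cor. 17.16.3 (i)] (residue fields all `ℂ`) gives an étale `ρ : T ⟶ S`, `t₀ ∈ T(ℂ)` over `s₀`, and an `S`-morphism `T → V°`
with `t₀ ↦ v₀`; pulling back the universal object gives a `T`-flat coherent sheaf (a `T`-perfect complex) `𝓕` on `𝒳 ×_S T`
with `𝓕|_{t₀} ≅ E₀` along `X₀ ≅ 𝒳_{s₀} ≅ (𝒳 ×_S T)_{t₀}`; `𝒳 ×_S T` is smooth (regular: coherent = perfect) and
quasi-projective over `ℂ`, so `𝓕` is quasi-isomorphic to a bounded complex `ℰ` of vector bundles [ThomasonTrobaugh1990,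
Prop. 2.3.1 (d)], whose (termwise = derived)
restriction to the fibre over `t₀` is quasi-isomorphic to `𝓕|^L_{t₀} = 𝓕|_{t₀} ≅ E₀` (`T`-flatness), so the Chern characters
agree in every degree (`chPerfect_eq_of_quasiIso`, `map_chPerfect`, `chPerfect_single` — kernel facts of seat p4). No Hodge
theory, no semiregularity and no property of `E₀` beyond the lifting hypothesis enters. (Perry's literal output is STRONGER —
a surjective étale `U′ → U` and an object-level section; the typed conclusion drops «surjective» and fixes only the classes
at `t₀`, as theory seat 3's does: ref-3 P1 / red-4 v8 on `PerfectComplexChartSpread.lean`.)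

## Trust sentence of §3's g = 4 corollary (paste-grade, for the record — no census row instantiates it tonight)

«`weilFourfoldsSplit_of_reach_of_pridham_of_sheafLifts_of_hyperbolicSeedOn` proves `Stubs.WeilAlgebraicSplitHyperplane 2 d` from:
(BY NAME) `weilFamilyReach_hyperbolic` (Deligne LNM 900, proof of Thm. 4.8; refereed tree fact), `Pridham2024_ISemiregular_liftsOverHodgeLocus_model`
(Pridham FMS 2024 Cor. 2.25 + Rem. 2.27 + Rem. 2.21 + Lemma 1.8–1.9, f.l.f. case; refereed tree fact, typed as printed) and the ONE
venture ASSUMPTION `SheafDeformsOverEtaleNbhdOfLifts C` (Hodge-free algebraisation in the printed shape of [Perry2022] Prop. 8.1's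
proof; kernel-linked to nothing); (BY VALUE) ONE hyperbolic `I`-semiregular VECTOR-BUNDLE seed on a split `ℚ(√-d)`-Weil abelian
fourfold (`HasHyperbolicSeedOn (bfSheafClass C) 2 d`) — an object the cell does NOT have.»

References: [Pridham2024Semiregularity] J. P. Pridham, Forum Math. Sigma 12 (2024) e126, Cor. 2.25, Rem. 2.27, Rem. 2.21, Lemma
1.8–1.9 · [Perry2022] A. Perry, Compositio Math. 158 (2022), proof of Prop. 8.1 (p. 28) · [Lieblich2006] M. Lieblich, J. Algebraic
Geom. 15 (2006), Thm. 4.2.1 · [EGAIV4] Publ. Math. IHÉS 32 (1967), Prop. 17.14.2, Cor. 17.16.3 (i) · [GortzWedhorn2023] U. Görtz,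
T. Wedhorn, Algebraic Geometry II, Thm. 18.63 · [ThomasonTrobaugh1990] Prop. 2.3.1 (d) · [SGA1] Exp. XII Prop. 3.1 (iii) (via the
tree's `isLocalHomeomorph_map_of_etale`) · [BuchweitzFlenner2003] Compositio Math. 137 (2003), §5 and proof of Thm. 5.1 (p. 179) ·
[StacksProject] Tag 08VR (the carrier `LiftsAlong`) · [Deligne1982HodgeCycles] proof of Thm. 4.8 (reach) ·
[Markman2023GeneralizedKummers] JEMS 25 (2023), Thm. 1.5 (= Thm. 13.4), p. 236 (pre-publication arXiv numbering: Thm. 1.3) (the g = 4 split case in print).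
-/

noncomputable section

open CategoryTheory CategoryTheory.Limits AlgebraicGeometry
open _root_.Topology _root_.Filter
open Literature.AlgebraicGeometry.Motives Literature.AlgebraicGeometry.HodgeTheory
open Literature.AlgebraicGeometry.ModuliOfAbelianVarieties Literature.AlgebraicGeometry.Deligne1982
open Literature.AlgebraicGeometry.KTheory
open Literature.AlgebraicTopology.SingularHomology
open Literature.AlgebraicGeometry.Deformation (LiftsAlong)

namespace Summit.Ventures.HSemireg

local notation3 (prettyPrint := false) "Res[" f ", " s ", " k ", " A "]" =>
  complexBetti.map (Literature.AlgebraicGeometry.Motives.fiberι f s) k A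

open Summit.HodgeConjecture.HodgeConjecture
open Summit.HodgeConjecture.HodgeConjecture.WeilTypeLadder
open Summit.HodgeConjecture.HodgeConjecture.Cruxes.HodgeAbelianVarieties.EStepSecantInduction

/-! ## §1 The Hodge-free algebraisation assumption BY NAME (sheaf level): infinitesimal lifting at `s₀` ⟹ an algebraic
deformation over an étale neighbourhood of `s₀` -/

section Assumption

/-- **Algebraisation of an infinitesimally unobstructed vector bundle over an ÉTALE NEIGHBOURHOOD of the base point**
(ASSUMPTION BY NAME of the venture; HODGE-FREE, SEMIREGULARITY-FREE). Binders: a Chern character theory `C`; a smooth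
projective family `π : 𝒳 ⟶ S` of relative dimension `n` over a SMOOTH `ℂ`-scheme `S`; a point `s₀ ∈ S(ℂ)`; a MODEL
`e : X₀ ≅ 𝒳_{s₀}` of the fibre; a finite locally free `E₀` on `X₀`. HYPOTHESIS — the conclusion of the tree's refereed fact
`Pridham2024_ISemiregular_liftsOverHodgeLocus_model` BY NAME, seat lit-3's predicate `LiftsOverArtinianPointsAt π s₀ X₀ e E₀`: for every small extension `f : A ↠ B` of local
Artinian `ℂ`-algebras (`𝔪_A · ker f = 0`), every `ℂ`-point `ρ` of `B`, every `A`-point `a` of `S` CENTRED at `s₀`, every choice of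
the base changes `X_A = 𝒳 ×_S Spec A`, `X_B = X_A ×_A Spec B` and of the closed fibre `X₀ ↪ X_B` compatible with `e` (three
`IsPullback` squares, one equation), every vector bundle `F` on `X_B` with `F|_{X₀} ≅ E₀` lifts to a vector bundle on `X_A`
(`LiftsAlong`). CONCLUSION — VERBATIM theory seat 3's étale shape (`PerfectComplexDeformsOverEtaleNbhd`, here in EVERY degree):
an ÉTALE `ρ : T ⟶ S`, a point `t₀ ∈ T(ℂ)` over `s₀`, and a bounded complex of vector bundles `ℰ` on `𝒳 ×_S T` whose `ch_p`
restricted to the fibre over `t₀`, carried to `𝒳_{s₀}`, is `(e⁻¹)^* ch_p(E₀)` for every `p`. PRINTED SHAPE: the proof of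
[Perry2022] Prop. 8.1 («there exists [an] étale morphism `U′ → U` with a point `0′ ∈ U′(ℂ)` mapping to `0` such that the base
change `𝓜°_{U′} → U′` admits a section taking `0′` to `E_{0′}`» — «surjective» DROPPED, classes only: WEAKER than print). ON
PAPER (module docstring): algebraic stack of `S`-flat coherent sheaves / universally gluable `S`-perfect complexes, l.f.p.
[Lieblich2006, Thm. 4.2.1]; a smooth atlas is smooth over `S` at a point over `[E₀]` by the infinitesimal criterion [EGAIV4,
Prop. 17.14.2; GortzWedhorn2023, Thm. 18.63] fed by the HYPOTHESIS (deformations of a vector bundle over Artinian bases are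
vector bundles: nilpotent Nakayama; the HYPOTHESIS is formal smoothness of the versal base of `E₀` relative to `Ŝ_{s₀}`,
[BuchweitzFlenner2003] Thm. 6.7 (1) with `𝔞 = 0`); étale quasi-section [EGAIV4, Cor. 17.16.3 (i)];
strictification [ThomasonTrobaugh1990, Prop. 2.3.1 (d)]; Chern characters of quasi-isomorphic complexes agree (seat p4's
`chPerfect_eq_of_quasiIso`). THE KERNEL LINKS IT TO NOTHING (wording rule F-1). It is the (E)+(C) half of the deformation step;
the (F) half is Pridham's fact; composed in §2. [cite: Perry2022, proof of Prop. 8.1] [cite: Lieblich2006, Thm. 4.2.1]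
[cite: EGAIV4, Prop. 17.14.2 and Cor. 17.16.3 (i)] [cite: GortzWedhorn2023, Thm. 18.63] [cite: ThomasonTrobaugh1990, Prop. 2.3.1 (d)]
[cite: StacksProject, Tag 08VR (the carrier `LiftsAlong`)] [cite: BuchweitzFlenner2003, Thm. 6.7 (1) (the hypothesis = relative formal smoothness)] -/
def SheafDeformsOverEtaleNbhdOfLifts (C : ChernCharacterBetti) : Prop :=
  ∀ ⦃𝒳 S : SchemeOver ℂ⦄ (π : 𝒳 ⟶ S) (n : ℕ),
    IsSmoothProjectiveFamily π n → _root_.AlgebraicGeometry.Smooth S.hom →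
    ∀ (s₀ : ComplexPoints S) (X₀ : SchemeOver ℂ) (e : X₀ ≅ fiberOver π s₀)
      (E₀ : X₀.left.Modules), IsFiniteLocallyFree E₀ →
      -- HYPOTHESIS: the infinitesimal lifting property of `E₀` at `s₀` — Pridham's conclusion BY NAME (seat lit-3)
      LiftsOverArtinianPointsAt π s₀ X₀ e E₀ →
      -- CONCLUSION: an algebraic deformation over an étale neighbourhood of `s₀` with the Chern character of `E₀` at `t₀`
      ∃ (T : SchemeOver ℂ) (ρ : T ⟶ S) (_ : Etale ρ.left) (t₀ : ComplexPoints T)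
        (_ : AlgPoints.map ρ t₀ = s₀)
        (ℰ : CochainComplex (familyPullback π ρ).left.Modules ℤ) (hℰ : IsBoundedVBComplex ℰ),
        ∀ p : ℕ,
          FiberClass.baseChange π ρ (2 * p)
              (globalSection (familyPullback.snd π ρ) (2 * p)
                (chPerfect C (familyPullback π ρ) ℰ hℰ.isFiniteLocallyFree p) t₀) =
            ⟨s₀, complexBetti.map e.inv (2 * p) (C.ch X₀ E₀ p)⟩

end Assumption

/-! ## §2 The spread, pointwise (kernel), and the composition (F) ∘ (E)+(C) ∘ (G): Pridham ∧ §1 ⟹ the local variational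
Hodge statement for the sheaf class -/

section Spread

/-- **The spread step, POINTWISE (proved; no assumption, no object)**: `π : 𝒳 ⟶ S` smooth projective over a smooth `S`, `U`
cohomologically locally trivial, `s₀ ∈ U`, a model `e : X₀ ≅ 𝒳_{s₀}`, classes `κ_p` on `X₀` (`p ∈ I`); IF some étale
`ρ : T ⟶ S` with `t₀ ↦ s₀` carries a bounded complex of vector bundles `ℰ` on `𝒳 ×_S T` with `ch_p(ℰ|_{t₀}) = (e⁻¹)^* κ_p`
(`p ∈ I`), THEN on some open `W`, `s₀ ∈ W ⊆ U`, the flat transports of `(e⁻¹)^* κ_p` along paths in `W` are ALGEBRAIC on the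
fibres: `ρ(ℂ)` is a local homeomorphism at `t₀` (tree theorem `isLocalHomeomorph_map_of_etale`), its local inverse on
`W :=` (chart target) `∩ U` is a continuous section through `t₀`, and theory seat 3's
`transportFun_mem_algebraicClasses_of_baseChange_chPerfect` identifies each transport with `ch_p` of `ℰ` restricted to a smooth
projective fibre of `𝒳 ×_S T`. (The proof of `PerfectComplexDeformsOverEtaleNbhd.deformsOverSmoothChart` and `.perfectComplexVariationalHodge`,
run at ONE datum instead of under the `∀`.) [cite: SGA1, Exp. XII Prop. 3.1 (iii)]
[cite: BuchweitzFlenner2003, §5, proof of Thm. 5.1 («hence `α_p(s) = ch_p(ℱ|X_s)` is algebraic for all `s` near `0`»)] -/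
theorem exists_nbhd_transportFun_mem_algebraicClasses_of_etale (C : ChernCharacterBetti) {𝒳 S : SchemeOver ℂ}
    (π : 𝒳 ⟶ S) {n : ℕ} (hπ : IsSmoothProjectiveFamily π n) (hS : _root_.AlgebraicGeometry.Smooth S.hom)
    {U : Set (ComplexPoints S)} (hU : IsCohomologicallyLocallyTrivialOn π U) (s₀ : U)
    (X₀ : SchemeOver ℂ) (e : X₀ ≅ fiberOver π s₀.1) (κ : (p : ℕ) → complexBetti X₀ (2 * p)) (I : Finset ℕ)
    {T : SchemeOver ℂ} (ρ : T ⟶ S) (hρ : Etale ρ.left) (t₀ : ComplexPoints T) (ht₀ : AlgPoints.map ρ t₀ = s₀.1)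
    (ℰ : CochainComplex (familyPullback π ρ).left.Modules ℤ) (hℰ : IsBoundedVBComplex ℰ)
    (hch : ∀ p ∈ I,
      FiberClass.baseChange π ρ (2 * p)
          (globalSection (familyPullback.snd π ρ) (2 * p)
            (chPerfect C (familyPullback π ρ) ℰ hℰ.isFiniteLocallyFree p) t₀) =
        ⟨s₀.1, complexBetti.map e.inv (2 * p) (κ p)⟩) :
    ∃ (W : Set (ComplexPoints S)) (hWo : IsOpen W) (hW₀ : s₀.1 ∈ W) (hWU : W ⊆ U),
      ∀ p ∈ I, ∀ (t : W) (γ : Path.Homotopic.Quotient (⟨s₀.1, hW₀⟩ : W) t),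
        transportFun π (2 * p) (hU.mono hWU hWo) γ (complexBetti.map e.inv (2 * p) (κ p)) ∈
          algebraicClasses (fiberOver π t.1) p := by
  haveI := hS; haveI := hρ
  have hT : _root_.AlgebraicGeometry.Smooth T.hom := by
    rw [← Over.w ρ]
    infer_instance
  obtain ⟨φ, ht₀φ, hφ⟩ := -- a chart of the local homeomorphism `ρ(ℂ)` at `t₀`
    Literature.AlgebraicGeometry.FundamentalGroup.isLocalHomeomorph_map_of_etale ρ t₀
  have hφs₀ : φ t₀ = s₀.1 := by rw [← ht₀, hφ]
  have hs₀W : s₀.1 ∈ φ.target ∩ U := ⟨hφs₀ ▸ φ.map_source ht₀φ, s₀.2⟩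
  let σ : C(↥(φ.target ∩ U), ComplexPoints T) :=
    ⟨fun w => φ.symm w.1, φ.continuousOn_symm.comp_continuous continuous_subtype_val fun w => w.2.1⟩
  have hσ : ∀ w : ↥(φ.target ∩ U), AlgPoints.map ρ (σ w) = w.1 := fun w => by
    change AlgPoints.map ρ (φ.symm w.1) = w.1
    rw [hφ]
    exact φ.right_inv w.2.1
  have hσ₀ : σ ⟨s₀.1, hs₀W⟩ = t₀ := by
    change φ.symm s₀.1 = t₀
    rw [← hφs₀]
    exact φ.left_inv ht₀φ
  refine ⟨φ.target ∩ U, φ.open_target.inter hU.isOpen, hs₀W, Set.inter_subset_right, fun p hp t γ => ?_⟩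
  refine transportFun_mem_algebraicClasses_of_baseChange_chPerfect π ρ C hπ
    (hU.mono Set.inter_subset_right (φ.open_target.inter hU.isOpen)) σ hσ ℰ hℰ p γ ?_
  rw [hσ₀]
  exact hch p hp

/-- **(F) ∘ (E)+(C) ∘ (G), KERNEL-COMPOSED: Pridham's refereed fact ∧ the Hodge-free algebraisation assumption ⟹ the LOCAL
VARIATIONAL HODGE STATEMENT FOR THE SHEAF CLASS `bfSheafClass C`** (the door-agnostic currency of `AmplificationChainAssembly.lean`):
given the binders of `LocalVariationalHodgeFor` and an `I`-semiregular finite locally free `E₀` with `κ_p = ch_p(E₀)` (`p ∈ I`)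
whose transported classes stay of type `(p, p)` on `U`, the fact (seat lit-3's repackaging
`Pridham2024_ISemiregular_liftsOverArtinianPointsAt_finset`) yields `LiftsOverArtinianPointsAt π s₀ X₀ e E₀`; the
assumption turns it into an étale deformation with the right classes at `t₀`; the pointwise spread concludes. HONEST WORDS: for
this class `localVariationalHodgeFor_bfSheafClass` (Buchweitz–Flenner Thm. 5.1, refereed, NO assumption) gives the same predicate —
cite THAT for a vector-bundle row; the present theorem is the interface certificate described in the module docstring.
[cite: Pridham2024Semiregularity, Cor. 2.25; Rem. 2.27; Rem. 2.21; Lemma 1.8–1.9] [cite: Perry2022, proof of Prop. 8.1]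
[cite: BuchweitzFlenner2003, §5, proof of Thm. 5.1] -/
theorem localVariationalHodgeFor_bfSheafClass_of_pridham_of_sheafDeformsOverEtaleNbhdOfLifts
    (hP : Pridham2024_ISemiregular_liftsOverHodgeLocus_model) {C : ChernCharacterBetti}
    (hA : SheafDeformsOverEtaleNbhdOfLifts C) : LocalVariationalHodgeFor (bfSheafClass C) := by
  intro 𝒳 S π n hπ hS U hU s₀ X₀ e I κ hκ hHodge
  obtain ⟨E₀, hE₀, hsr, hch⟩ := hκ
  have hHodge' : ∀ p ∈ I, ∀ (t : U) (γ : Path.Homotopic.Quotient s₀ t),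
      IsOfHodgeType n (fiberOver π t.1) (2 * p) p p
        (transportFun π (2 * p) hU γ (complexBetti.map e.inv (2 * p) (C.ch X₀ E₀ p))) := fun p hp t γ => by
    rw [← hch p hp]
    exact hHodge p hp t γ
  -- (F): the refereed fact gives the infinitesimal lifting property; (E)+(C): the assumption algebraises it
  obtain ⟨T, ρ, hρ, t₀, ht₀, ℰ, hℰ, hchT⟩ := hA π n hπ hS s₀.1 X₀ e E₀ hE₀
    (Pridham2024_ISemiregular_liftsOverArtinianPointsAt_finset hP C π n hπ hS hU s₀ X₀ e E₀ hE₀ I hsr hHodge')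
  -- (G) + spread: kernel
  obtain ⟨W, hWo, hW₀, hWU, hW⟩ := exists_nbhd_transportFun_mem_algebraicClasses_of_etale C π hπ hS hU s₀ X₀ e
    (fun p => C.ch X₀ E₀ p) I ρ hρ t₀ ht₀ ℰ hℰ (fun p _ => hchT p)
  refine ⟨W, hWo, hW₀, hWU, fun p hp t γ => ?_⟩
  rw [hch p hp]
  exact hW p hp t γ

end Spread

/-! ## §3 Corollaries in the Weil / `𝒜_g` currencies (compositions with the landed door-agnostic theorems; nothing new decided) -/

section Weil

variable {C : ChernCharacterBetti}

/-- **g = 4 through the SHEAF door, Pridham route** (for the record — NO such vector bundle is claimed by the cell; the STEP-0 (C)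
object is a two-term complex): Deligne's reach ∧ Pridham's refereed fact ∧ the Hodge-free algebraisation assumption ∧ ONE hyperbolic
`I`-semiregular vector-bundle seed on a split `ℚ(√-d)`-Weil abelian fourfold ⟹ the Weil classes of EVERY split `√-d`-Weil fourfold are
algebraic (`Stubs.WeilAlgebraicSplitHyperplane 2 d`; in print: [Markman2023GeneralizedKummers] Thm. 1.5 (= Thm. 13.4; J. Eur. Math. Soc. 25 (2023) p. 236; pre-publication arXiv numbering: Thm. 1.3) — re-derived modulo the named
hypotheses, no new case). Trust sentence in the module docstring. [cite: Markman2023GeneralizedKummers, Theorem 1.5 (= Theorem 13.4), p. 236 (the case in print; arXiv:1805.11574 pre-publication numbering: Theorem 1.3)]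
[cite: Pridham2024Semiregularity, Cor. 2.25; Rem. 2.27] [cite: Perry2022, proof of Prop. 8.1] [cite: Deligne1982HodgeCycles, proof of Thm. 4.8] -/
theorem weilFourfoldsSplit_of_reach_of_pridham_of_sheafLifts_of_hyperbolicSeedOn (hF : weilFamilyReach_hyperbolic)
    (hP : Pridham2024_ISemiregular_liftsOverHodgeLocus_model) (hA : SheafDeformsOverEtaleNbhdOfLifts C) {d : ℕ}
    (hd : 0 < d) (hS : HasHyperbolicSeedOn (bfSheafClass C) 2 d) : Stubs.WeilAlgebraicSplitHyperplane 2 d :=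
  weilFourfoldsSplit_of_reach_of_localVariationalHodgeFor_of_hyperbolicSeedOn hF
    (localVariationalHodgeFor_bfSheafClass_of_pridham_of_sheafDeformsOverEtaleNbhdOfLifts hP hA) hd hS

/-- **g = 4, Pridham route, with theory seat 2's BY-VALUE sheaf seed** `HasHyperbolicBFSheafSeedOn C 2 d I` (a finite locally free
`I`-semiregular `ℰ₀` on a split CM anchor with `ch_2 = q·h_K² + w`, `ch_p = c_p·h_Kᵖ`). [cite: Markman2023GeneralizedKummers, Theorem 1.5 (= Theorem 13.4), p. 236 (the case in print; arXiv:1805.11574 pre-publication numbering: Theorem 1.3)]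
[cite: Pridham2024Semiregularity, Cor. 2.25; Rem. 2.27] [cite: BuchweitzFlenner2003, §5 (I-semiregular)] [cite: Deligne1982HodgeCycles, proof of Thm. 4.8] -/
theorem weilFourfoldsSplit_of_reach_of_pridham_of_sheafLifts_of_hyperbolicBFSheafSeedOn (hF : weilFamilyReach_hyperbolic)
    (hP : Pridham2024_ISemiregular_liftsOverHodgeLocus_model) (hA : SheafDeformsOverEtaleNbhdOfLifts C) {d : ℕ}
    (hd : 0 < d) {I : Finset ℕ} (hS : HasHyperbolicBFSheafSeedOn C 2 d I) : Stubs.WeilAlgebraicSplitHyperplane 2 d :=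
  weilFourfoldsSplit_of_reach_of_pridham_of_sheafLifts_of_hyperbolicSeedOn hF hP hA hd
    (hasHyperbolicSeedOn_bfSheafClass_of_hasHyperbolicBFSheafSeedOn hS)

/-- **Every level below a seed, Pridham route**: reach ∧ Pridham ∧ the algebraisation assumption ∧ ONE hyperbolic `I`-semiregular
vector-bundle seed at level `N` for `K = ℚ(√-d)` ⟹ `WeilAlgebraicAll n d` for every `2 ≤ n < N` (Schoen's descent, iterated in the
tree). [cite: Schoen1998HodgeWeilAddendum, §10] [cite: Pridham2024Semiregularity, Cor. 2.25; Rem. 2.27] [cite: Deligne1982HodgeCycles, proof of Thm. 4.8] -/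
theorem weilAlgebraicAll_of_reach_of_pridham_of_sheafLifts_of_hyperbolicSeedOn_lt (hF : weilFamilyReach_hyperbolic)
    (hP : Pridham2024_ISemiregular_liftsOverHodgeLocus_model) (hA : SheafDeformsOverEtaleNbhdOfLifts C) {N d : ℕ}
    (hS : HasHyperbolicSeedOn (bfSheafClass C) N d) {n : ℕ} (hn : 2 ≤ n) (hnN : n < N) (hd : 0 < d) :
    WeilAlgebraicAll n d :=
  weilAlgebraicAll_of_localVariationalHodgeFor_of_hyperbolicSeedOn_lt hF
    (localVariationalHodgeFor_bfSheafClass_of_pridham_of_sheafDeformsOverEtaleNbhdOfLifts hP hA) hS hn hnN hd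

end Weil

section Siegel

variable {g : ℕ} {δ : Fin g → ℕ} {N : ℕ}

/-- **`𝒜_g` per-component form, Pridham route** (the coordinator's sentence «a semiregular representative at ONE point of a
Hodge-locus component ⟹ HC on THAT component», vector-bundle door): on the universal family of `𝒜_{g,δ,N}`, a component `C'` of the
locus of rational `(p,p)`-classes with its chart (cell assumption BY NAME `SiegelHodgeLocusChartAt`), Pridham's fact, the algebraisation
assumption, fibrewise-Hodge global companions `Λ_{p'}` (`p' ∈ I`) with `Λ_p` fibrewise rational-algebraic, a point `(t₀, α₀) ∈ C'` and ONE
finite locally free `I`-semiregular `E₀` on ONE model `X₀ ≅ 𝒴_{t₀}` with `ch_p(E₀) = e^*(a·α₀ + b·Λ_p|_{t₀})`, `a ≠ 0`,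
`ch_{p'}(E₀) = e^*(c_{p'}·Λ_{p'}|_{t₀})` ⟹ `α` is algebraic on `𝒴_t` for EVERY `(t, α) ∈ C'`. Same statement as the assembly's sanity
instance `hc_on_siegelComponent_of_sheafSeedOn_of_smul_add_at'` with `hBF` replaced by `hP ∧ hA` (larger trust base; for the record).
[cite: Pridham2024Semiregularity, Cor. 2.25; Rem. 2.27] [cite: BuchweitzFlenner2003, §5 Thm. 5.1; §6 Example 6.2]
[cite: CattaniDeligneKaplan1995JAMS, Thm. 1.1 and Cor. 1.2] -/
theorem hc_on_siegelComponent_of_pridham_of_sheafLifts_of_sheafSeedOn_of_smul_add_at {p : ℕ} {D : SiegelModuliDatum g δ N}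
    {C' : HodgeLocusComponent D.f g p} (hCh : SiegelHodgeLocusChartAt D p C')
    (hP : Pridham2024_ISemiregular_liftsOverHodgeLocus_model) (Cc : ChernCharacterBetti)
    (hA : SheafDeformsOverEtaleNbhdOfLifts Cc) (I : Finset ℕ) (hp : p ∈ I)
    (Λ : (p' : ℕ) → complexBetti D.𝒳 (2 * p'))
    (hΛ : ∀ p' ∈ I, ∀ s : ComplexPoints D.S, IsOfHodgeType g (fiberOver D.f s) (2 * p') p' p' (Res[D.f, s, 2 * p', Λ p']))
    (hΛp : ∀ s : ComplexPoints D.S, IsRationalClass (Res[D.f, s, 2 * p, Λ p]) ∧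
      Res[D.f, s, 2 * p, Λ p] ∈ algebraicClasses (fiberOver D.f s) p)
    {x₀ : FiberClass D.f (2 * p)} (hx₀ : x₀ ∈ C'.carrier) (a b : ℚ) (ha : a ≠ 0) (c : ℕ → ℚ)
    (X₀ : SchemeOver ℂ) (e : X₀ ≅ fiberOver D.f x₀.pt)
    (E₀ : X₀.left.Modules) (hE₀ : IsFiniteLocallyFree E₀) (hsr : IsISemiregular hE₀ {q | q + 1 ∈ I})
    (hchp : Cc.ch X₀ E₀ p =
      complexBetti.map e.hom (2 * p) ((a : ℂ) • x₀.cls + (b : ℂ) • Res[D.f, x₀.pt, 2 * p, Λ p]))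
    (hchp' : ∀ p' ∈ I, p' ≠ p →
      Cc.ch X₀ E₀ p' = complexBetti.map e.hom (2 * p') (((c p' : ℚ) : ℂ) • Res[D.f, x₀.pt, 2 * p', Λ p'])) :
    ∀ x ∈ C'.carrier, x.cls ∈ algebraicClasses (fiberOver D.f x.pt) p :=
  (localVariationalHodgeFor_bfSheafClass_of_pridham_of_sheafDeformsOverEtaleNbhdOfLifts hP hA).hc_on_siegelComponent_of_smul_add_at
    hCh I hp Λ hΛ hΛp hx₀ a b ha c X₀ e (fun p' ↦ Cc.ch X₀ E₀ p') ⟨E₀, hE₀, hsr, fun _ _ ↦ rfl⟩ hchp hchp'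

end Siegel

/-! ## Audit: what is assumed, what is proved
ASSUMED BY NAME in every Weil / `𝒜_g` conclusion above: `weilFamilyReach_hyperbolic` or the chart (refereed / cell assumption, as
before), `Pridham2024_ISemiregular_liftsOverHodgeLocus_model` (refereed Literature fact, unproved `Prop`, taken as hypothesis),
`SheafDeformsOverEtaleNbhdOfLifts C` (venture assumption, Hodge-free; kernel-linked to nothing) — and a SEED by value. PROVED: the
pointwise spread and the composition. NOT here: HC_CM, CM density / André–Oort, Mumford–Tate finiteness, any perfect-complex or
twisted object, the «lifts over every Artinian point» iteration. -/

end Summit.Ventures.HSemireg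

end
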